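import Summits.NavierStokesRegularity.NavierStokesRegularity.Theses.TerminalTrace

/-!
# `TypeITraceScarL3` in the uniformly-weak-`L³` class — a printed theorem closes it (nsreg-p2 g29, ROUND-29)

Item `TerminalTrace.TypeITraceScarL3` (stmt-NavierStokesRegularity-18385) asks: at a singular point
`x₀` of a Type-I blow-up at time `T`, the terminal profile `u(T)` is not in `L³` near `x₀`.

**The weak-`L³` fence.**  If in addition `sup_{0<t<T} ‖u(t)‖_{L^{3,∞}(ℝ³)} < ∞` (ANY size), the
conclusion follows in two lines from the printed criterion of Choe–Wolf–Yang (Math. Ann. 377 (2020)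
617–642, Theorem 1 = arXiv:1611.04725 Thm 1): for every `M` there is `ε(M) ∈ (0, ¼)` such that a
Leray–Hopf solution with `ess sup_t ‖u(t)‖_{L^{3,w}} ≤ M` and
`r⁻³ · |{x ∈ B(x₀,r) : |u(x,t₀)| > ε/r}| ≤ ε` for some `0 < r ≤ √t₀` is bounded in `Q((t₀,x₀), εr)`.
An `L³` terminal trace near `x₀` makes the density condition hold at every small `r` (Chebyshev +
absolute continuity), so `(x₀, T)` would be regular.

This file records the implication with the criterion SPELLED OUT as a hypothesis `hCWY` (viscosity `ν`,
read at the terminal time `t₀ = T` of the Leray–Hopf interval: the printed proof uses only backward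
cylinders `Q(z₀, ρ) ⊂ ℝ³ × (0, t₀]` and the `C([0,T]; L²)` trace, and transports from `ν = 1` by
`v(y,s) = ν⁻¹ u(y, s/ν)`).  When the criterion is typed as a Literature fact the hypothesis discharges by
name.  Consequence for the item: its open core lies entirely OUTSIDE `L^∞_t L^{3,∞}_x`, i.e. (by
Choe–Wolf–Yang Thm 2: uniformly weak-`L³` ⇒ finitely many singular points at each time) in the regime of
infinitely many terminal-time singular points accumulating at `x₀` — the «loud dust» of line
`annulus-dichotomy`.
-/

set_option linter.dupNamespace false

open MeasureTheory Set Filter Topology Metric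
open scoped ENNReal NNReal
open Literature.Analysis.FluidPDE

namespace Summit.NavierStokesRegularity.NavierStokesRegularity.Theorems.TypeITraceScarL3

/-- **`TypeITraceScarL3` restricted to the uniformly-weak-`L³` class, modulo the printed
Choe–Wolf–Yang criterion** (hypothesis `hCWY`, their Theorem 1 at viscosity `ν`, terminal-time reading).
The class hypothesis `hW` is `sup_{0<t<T} ‖u(t)‖_{L^{3,∞}(ℝ³)} ≤ M`, written with the distribution
function (`h³·|{|u(t)| > h}| ≤ M³`) in `ℝ≥0∞` to avoid junk values; the item's remaining binders are
verbatim (the classical / decay / Type-I hypotheses are not even used). [folklore] -/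
theorem typeITraceScarL3_of_weakL3Bounded :
    ∀ (ν T : ℝ), 0 < ν → 0 < T →
    -- the printed criterion (Choe–Wolf–Yang 2020, Theorem 1), viscosity `ν`, `t₀ ∈ (0, T']`
    (∀ M : ℝ, 0 < M → ∃ ε : ℝ, 0 < ε ∧ ε < 1 / 4 ∧
      ∀ (T' : ℝ) (v : ℝ → EuclideanSpace ℝ (Fin 3) → EuclideanSpace ℝ (Fin 3)), 0 < T' → IsLerayHopfOn T' ν 0 (v 0) v →
        (∀ t ∈ Ioo 0 T', ∀ h : ℝ, 0 < h →
          ENNReal.ofReal (h ^ 3) * volume {x : EuclideanSpace ℝ (Fin 3) | h < ‖v t x‖} ≤ ENNReal.ofReal (M ^ 3)) →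
        ∀ (x₀ : EuclideanSpace ℝ (Fin 3)) (t₀ r : ℝ), t₀ ∈ Ioc 0 T' → 0 < r → r ≤ Real.sqrt t₀ →
          volume.restrict (ball x₀ r) {x : EuclideanSpace ℝ (Fin 3) | ε / r < ‖v t₀ x‖} ≤ ENNReal.ofReal (ε * r ^ 3) →
          eLpNorm (Function.uncurry v) ⊤
            (volume.restrict (parabolicCylinder (ε * r) (t₀, x₀))) < ⊤) →
    ∀ (u : ℝ → EuclideanSpace ℝ (Fin 3) → EuclideanSpace ℝ (Fin 3)) (p : ℝ → EuclideanSpace ℝ (Fin 3) → ℝ),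
      IsClassicalNSSolutionOn (Set.Ico 0 T) ν 0 u p →
      IsLerayHopfOn T ν 0 (u 0) u →
      HasRapidSpatialDecay (u 0) →
      IsTypeIBlowup u T →
      -- the class: uniformly weak-L³ on `(0, T)`, any size `M`
      (∃ M : ℝ, 0 < M ∧ ∀ t ∈ Ioo 0 T, ∀ h : ℝ, 0 < h →
          ENNReal.ofReal (h ^ 3) * volume {x : EuclideanSpace ℝ (Fin 3) | h < ‖u t x‖} ≤ ENNReal.ofReal (M ^ 3)) →
      ∀ x₀ : EuclideanSpace ℝ (Fin 3),
        (∀ r : ℝ, 0 < r → eLpNorm (Function.uncurry u) ⊤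
          (volume.restrict (parabolicCylinder r (T, x₀))) = ⊤) →
        ∀ ρ : ℝ, 0 < ρ → ¬ MemLp (u T) 3 (volume.restrict (ball x₀ ρ)) := by
  intro ν T hν hT hCWY u p _hcl hLH _hdec _hTI hW x₀ hsing ρ hρ hL3
  obtain ⟨M, hM, hWb⟩ := hW
  obtain ⟨ε, hε, -, hcrit⟩ := hCWY M hM
  -- Step 1: `∫_{B(x₀,ρ)} |u(T)|³ < ∞` as a lower Lebesgue integral
  set μ : Measure (EuclideanSpace ℝ (Fin 3)) := volume.restrict (ball x₀ ρ) with hμ_def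
  set F : EuclideanSpace ℝ (Fin 3) → ℝ≥0∞ := fun x => ‖u T x‖ₑ ^ (3 : ℝ) with hF_def
  have hFmeas : AEMeasurable F μ :=
    (hL3.aestronglyMeasurable.enorm.pow_const (3 : ℝ))
  have hFint : ∫⁻ x, F x ∂μ ≠ ⊤ := by
    have h := lintegral_rpow_enorm_lt_top_of_eLpNorm_lt_top (by norm_num : (3 : ℝ≥0∞) ≠ 0)
      (by norm_num : (3 : ℝ≥0∞) ≠ ⊤) hL3.eLpNorm_lt_top
    have h3 : ENNReal.toReal 3 = (3 : ℝ) := by norm_num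
    rw [h3] at h
    exact h.ne
  -- Step 2: absolute continuity: small balls carry `L³`-mass `< ε⁴`
  have hε4 : ENNReal.ofReal (ε ^ 4) ≠ 0 := by
    rw [ne_eq, ENNReal.ofReal_eq_zero, not_le]; positivity
  obtain ⟨δ, hδ, hsmall⟩ := exists_pos_setLIntegral_lt_of_measure_lt hFint hε4
  -- Step 3: pick `r ∈ (0, min ρ √T]` with `volume (ball x₀ r) < δ`
  have hvol : Tendsto (fun r : ℝ => volume (ball x₀ r)) (𝓝[>] 0) (𝓝 0) := by
    set c : ℝ := (volume (ball (0 : EuclideanSpace ℝ (Fin 3)) 1)).toReal with hc_def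
    have h0 : Tendsto (fun r : ℝ => ENNReal.ofReal (r ^ 3 * c)) (𝓝 0)
        (𝓝 (ENNReal.ofReal ((0 : ℝ) ^ 3 * c))) :=
      (ENNReal.continuous_ofReal.tendsto _).comp
        (((continuous_pow 3).mul continuous_const).tendsto 0)
    rw [show ((0 : ℝ) ^ 3 * c) = 0 by ring, ENNReal.ofReal_zero] at h0
    refine (tendsto_nhdsWithin_of_tendsto_nhds h0).congr' ?_
    filter_upwards [self_mem_nhdsWithin] with r hr
    have hr' : (0 : ℝ) ≤ r := le_of_lt hr
    rw [hc_def, Measure.addHaar_ball volume x₀ hr', finrank_euclideanSpace_fin,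
      ENNReal.ofReal_mul (pow_nonneg hr' 3), ENNReal.ofReal_toReal measure_ball_lt_top.ne]
  have hev1 : ∀ᶠ r : ℝ in 𝓝[>] 0, volume (ball x₀ r) < δ := hvol (gt_mem_nhds hδ)
  have hev2 : ∀ᶠ r : ℝ in 𝓝[>] 0, r < ρ :=
    eventually_nhdsWithin_of_eventually_nhds (eventually_lt_nhds hρ)
  have hev3 : ∀ᶠ r : ℝ in 𝓝[>] 0, r < Real.sqrt T :=
    eventually_nhdsWithin_of_eventually_nhds (eventually_lt_nhds (Real.sqrt_pos.mpr hT))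
  have hev4 : ∀ᶠ r : ℝ in 𝓝[>] 0, r ∈ Ioi (0 : ℝ) := eventually_mem_nhdsWithin
  obtain ⟨r, hr1, hr2, hr3, hr4⟩ := (hev1.and (hev2.and (hev3.and hev4))).exists
  have hr : 0 < r := hr4
  -- Step 4: the density condition (7) at scale `r` by Chebyshev
  have hsub : ball x₀ r ⊆ ball x₀ ρ := ball_subset_ball hr2.le
  have hmass : ∫⁻ x in ball x₀ r, F x ∂volume < ENNReal.ofReal (ε ^ 4) := by
    have h1 : ∫⁻ x in ball x₀ r, F x ∂μ < ENNReal.ofReal (ε ^ 4) := by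
      refine hsmall _ ?_
      rw [hμ_def, Measure.restrict_apply measurableSet_ball,
        inter_eq_left.mpr hsub]
      exact hr1
    rwa [hμ_def, Measure.restrict_restrict measurableSet_ball, inter_eq_left.mpr hsub] at h1
  have hdens : volume.restrict (ball x₀ r) {x : EuclideanSpace ℝ (Fin 3) | ε / r < ‖u T x‖} ≤
      ENNReal.ofReal (ε * r ^ 3) := by
    set lev : ℝ≥0∞ := ENNReal.ofReal ((ε / r) ^ 3) with hlev_def
    have hlev0 : lev ≠ 0 := by
      rw [hlev_def, ne_eq, ENNReal.ofReal_eq_zero, not_le]; positivity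
    have hlevtop : lev ≠ ⊤ := ENNReal.ofReal_ne_top
    have hmono : {x : EuclideanSpace ℝ (Fin 3) | ε / r < ‖u T x‖} ⊆ {x : EuclideanSpace ℝ (Fin 3) | lev ≤ F x} := by
      intro x hx
      simp only [mem_setOf_eq] at hx ⊢
      rw [hF_def, hlev_def]
      dsimp only
      rw [← ofReal_norm, ENNReal.ofReal_rpow_of_nonneg (norm_nonneg _) (by norm_num)]
      refine ENNReal.ofReal_le_ofReal ?_
      have hεr : 0 ≤ ε / r := by positivity
      calc (ε / r) ^ 3 ≤ ‖u T x‖ ^ 3 := by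
            exact pow_le_pow_left₀ hεr hx.le 3
        _ = ‖u T x‖ ^ (3 : ℝ) := by norm_cast
    have hFmeas' : AEMeasurable F (volume.restrict (ball x₀ r)) := by
      have : volume.restrict (ball x₀ r) = μ.restrict (ball x₀ r) := by
        rw [hμ_def, Measure.restrict_restrict measurableSet_ball, inter_eq_left.mpr hsub]
      rw [this]
      exact hFmeas.restrict
    have hcheb := mul_meas_ge_le_lintegral₀ hFmeas' lev
    -- `lev · m ≤ ∫ F < ε⁴`, hence `m ≤ ε⁴ / lev = ε r³`
    have hm : volume.restrict (ball x₀ r) {x : EuclideanSpace ℝ (Fin 3) | lev ≤ F x} ≤ ENNReal.ofReal (ε ^ 4) / lev := by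
      rw [ENNReal.le_div_iff_mul_le (Or.inl hlev0) (Or.inl hlevtop), mul_comm]
      exact hcheb.trans hmass.le
    have hq : ENNReal.ofReal (ε ^ 4) / lev = ENNReal.ofReal (ε * r ^ 3) := by
      rw [hlev_def, ← ENNReal.ofReal_div_of_pos (by positivity)]
      congr 1
      field_simp
    calc volume.restrict (ball x₀ r) {x : EuclideanSpace ℝ (Fin 3) | ε / r < ‖u T x‖}
        ≤ volume.restrict (ball x₀ r) {x : EuclideanSpace ℝ (Fin 3) | lev ≤ F x} := measure_mono hmono
      _ ≤ ENNReal.ofReal (ε ^ 4) / lev := hm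
      _ = ENNReal.ofReal (ε * r ^ 3) := hq
  -- Step 5: the criterion gives boundedness in `Q((T,x₀), εr)`, contradicting the singular point
  have hbd := hcrit T u hT hLH hWb x₀ T r ⟨hT, le_rfl⟩ hr hr3.le hdens
  have hs := hsing (ε * r) (by positivity)
  exact absurd hs hbd.ne

end Summit.NavierStokesRegularity.NavierStokesRegularity.Theorems.TypeITraceScarL3
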